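import Mathlib
import HarnessLib
import Summits.HubbardSuperconductivity.HubbardSuperconductivity.Theorems.KLProgrammeH10TwoPointLimitKlAnisoAnchoredSectorCountWindow

/-!
# K3 ENGINE child `KLRegimeEngineV17F2` (stmt-HubbardSuperconductivity-20437), stub (b) import ι₂: NAMED DOORS for the log-free anchored
# anisotropic sector count — `klThinCountC`, `klThinCountC₃ R`, `klThinCountU₀ R`

Cell gate-hubbard-kl, seat p4 (g10), plan g17 (R41)(i) «E1-P2-THIN-COUNT».  WHY.  The deliverable
`card_bgmSectorSet_klAniso_anchored_le_linear_window` (`…KlAnisoAnchoredSectorCountWindow`) is an `∃ C, ∀ R, ∃ c₃ U₀, …` statement; the engine's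
stubs are keyed on NAMED doors (`c ≤ klEngC₃… P R`, `U ≤ klEngU₀… P R c`) and on a `G`-package constant.  This file names the three witnesses as
CLOSED TERMS (classical `choose`, the pattern of `klE4T6` in `…EngineV8DefsG7`), so that a door amendment `min klEngC₃… (klThinCountC₃ R)` /
`min klEngU₀… (klThinCountU₀ R)` and a `G`-slot `≥ klThinCountC` can consume the count BY NAME:

* §1 `klThinCountC` (the geometric constant; `R`-free), `klThinCountC_pos`; `klThinCountC₃ R`, `klThinCountU₀ R` (thresholds; `1` off the
  admissible set `∀ j, 0 ≤ R.Gfr j`), `klThinCountC₃_pos`, `klThinCountU₀_pos`;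
* §2 **`card_bgmSectorSet_klAniso_anchored_le_doors`** — the count under the named doors:
  `0 < c ≤ klThinCountC₃ R`, `0 < U ≤ klThinCountU₀ R`, `klBetaMin ≤ β ≤ e^{c/U²}`, `μ ∈ klWindowC`, `FrameOK R U (nScales β) ν K` ⟹
  `#{Ω ∈ bgmSectorSet L M (klAnisoFamily L M β μ K klE0 n) 4 : Ω p = s} ≤ klThinCountC · sectorCount n`.

Definitions with bodies + their order lemmas + one consumer theorem; nothing about the model is asserted; nothing asserts superconductivity.
References: BGM 2006 §2.8 (2.73), (2.76)–(2.80), Lemma 3.1 [cite: BenfattoGiulianiMastropietro2006]; Mastropietro 2008 (14.67) [cite: Mastropietro2008].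
-/

noncomputable section

namespace Summit.HubbardSuperconductivity.HubbardSuperconductivity.Theorems.KLRegimeSplit

set_option linter.dupNamespace false -- summit = problem name (single-conjunct summit), D-0017

open Real Finset Literature.MathematicalPhysics.QuantumLattice Literature.Probability.LatticeModels
open Summit.HubbardSuperconductivity.HubbardSuperconductivity.Theorems.KLProgrammeLegKernels
open Summit.HubbardSuperconductivity.HubbardSuperconductivity.Theorems.DispersionFlow
open Summit.HubbardSuperconductivity.HubbardSuperconductivity.Theorems.PerturbedFermiCurve

/-! ## §1 The named witnesses -/

open Classical in
/-- **`klThinCountC`** — the geometric constant of the log-free anchored anisotropic sector count on `klWindowC` (the classical witness `C` of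
`card_bgmSectorSet_klAniso_anchored_le_linear_window`; independent of `R`, `P`, `β`, `U`, `c`, `L`, `M`, the scale and the anchor). -/
def klThinCountC : ℝ := Classical.choose card_bgmSectorSet_klAniso_anchored_le_linear_window

/-- `0 < klThinCountC`. -/
theorem klThinCountC_pos : 0 < klThinCountC := (Classical.choose_spec card_bgmSectorSet_klAniso_anchored_le_linear_window).1

/-- The defining property of `klThinCountC`: for every admissible `R`, thresholds exist under which the anchored count is `≤ klThinCountC · sectorCount n`. -/
theorem klThinCountC_spec : ∀ R : RenConsts, (∀ j, 0 ≤ R.Gfr j) →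
    ∃ c₃ : ℝ, 0 < c₃ ∧ ∃ U₀ : ℝ, 0 < U₀ ∧
      ∀ c : ℝ, 0 < c → c ≤ c₃ → ∀ U : ℝ, 0 < U → U ≤ U₀ → ∀ β : ℝ, klBetaMin ≤ β → β ≤ Real.exp (c / U ^ 2) →
      ∀ μ ∈ klWindowC, ∀ (ν : ℝ) (K : TrigPolyC4v), FrameOK R U (nScales β) ν K →
      ∀ (L M : ℕ) [NeZero L] (n : ℕ) (p : Fin 4) (s : SectorLeg (sectorCount n)),
      ((((bgmSectorSet L M (klAnisoFamily L M β μ K klE0 n) 4).filter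
          (fun Ω : Fin 4 → SectorLeg (sectorCount n) => Ω p = s)).card : ℕ) : ℝ) ≤ klThinCountC * sectorCount n :=
  (Classical.choose_spec card_bgmSectorSet_klAniso_anchored_le_linear_window).2

open Classical in
/-- **`klThinCountC₃ R`** — the coupling-temperature door `c₃(R)` of the thin count (classical witness; `1` off the admissible set). -/
def klThinCountC₃ (R : RenConsts) : ℝ :=
  if h : (∀ j, 0 ≤ R.Gfr j) then Classical.choose (klThinCountC_spec R h) else 1

open Classical in
/-- **`klThinCountU₀ R`** — the coupling door `U₀(R)` of the thin count (classical witness; `1` off the admissible set). -/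
def klThinCountU₀ (R : RenConsts) : ℝ :=
  if h : (∀ j, 0 ≤ R.Gfr j) then Classical.choose (Classical.choose_spec (klThinCountC_spec R h)).2 else 1

/-- `0 < klThinCountC₃ R`. -/
theorem klThinCountC₃_pos (R : RenConsts) : 0 < klThinCountC₃ R := by
  classical
  unfold klThinCountC₃
  split_ifs with h
  · exact (Classical.choose_spec (klThinCountC_spec R h)).1
  · exact one_pos

/-- `0 < klThinCountU₀ R`. -/
theorem klThinCountU₀_pos (R : RenConsts) : 0 < klThinCountU₀ R := by
  classical
  unfold klThinCountU₀
  split_ifs with h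
  · exact (Classical.choose_spec (Classical.choose_spec (klThinCountC_spec R h)).2).1
  · exact one_pos

/-! ## §2 The count under the named doors -/

/-- **The log-free anchored anisotropic sector count UNDER THE NAMED DOORS**: for `R` with `0 ≤ R.Gfr j`, all `0 < c ≤ klThinCountC₃ R`,
`0 < U ≤ klThinCountU₀ R`, `klBetaMin ≤ β ≤ e^{c/U²}`, `μ ∈ klWindowC`, every frame with `FrameOK R U (nScales β) ν K`, every `L ≥ 1`, `M`, scale
`n`, anchor leg `p` and label `s`: `#{Ω ∈ bgmSectorSet L M (klAnisoFamily L M β μ K klE0 n) 4 : Ω p = s} ≤ klThinCountC · sectorCount n`.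
[cite: BenfattoGiulianiMastropietro2006, §2.8 (2.73), (2.76)–(2.80), Lemma 3.1, App. A3] -/
theorem card_bgmSectorSet_klAniso_anchored_le_doors {R : RenConsts} (hR : ∀ j, 0 ≤ R.Gfr j) {c : ℝ} (hc : 0 < c)
    (hc₃ : c ≤ klThinCountC₃ R) {U : ℝ} (hU : 0 < U) (hU₀ : U ≤ klThinCountU₀ R) {β : ℝ} (hβ : klBetaMin ≤ β)
    (hβc : β ≤ Real.exp (c / U ^ 2)) {μ : ℝ} (hμ : μ ∈ klWindowC) (ν : ℝ) {K : TrigPolyC4v} (hK : FrameOK R U (nScales β) ν K)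
    (L M : ℕ) [NeZero L] (n : ℕ) (p : Fin 4) (s : SectorLeg (sectorCount n)) :
    ((((bgmSectorSet L M (klAnisoFamily L M β μ K klE0 n) 4).filter
        (fun Ω : Fin 4 → SectorLeg (sectorCount n) => Ω p = s)).card : ℕ) : ℝ) ≤ klThinCountC * sectorCount n := by
  classical
  have h3 : klThinCountC₃ R = Classical.choose (klThinCountC_spec R hR) := by unfold klThinCountC₃; exact dif_pos hR
  have hU' : klThinCountU₀ R = Classical.choose (Classical.choose_spec (klThinCountC_spec R hR)).2 := by
    unfold klThinCountU₀; exact dif_pos hR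
  have hspec := (Classical.choose_spec (Classical.choose_spec (klThinCountC_spec R hR)).2).2
  rw [h3] at hc₃
  rw [hU'] at hU₀
  exact hspec c hc hc₃ U hU hU₀ β hβ hβc μ hμ ν K hK L M n p s

end Summit.HubbardSuperconductivity.HubbardSuperconductivity.Theorems.KLRegimeSplit

end
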